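import Literature.MathematicalPhysics.QuantumFieldTheory.Balaban1983to89.B8Eq138LandauFlatOrthogonalRec
import Literature.MathematicalPhysics.QuantumFieldTheory.Balaban1983to89.B8Eq191FlatStencils

/-!
# `Balaban1983to89.B8Eq191FlatStencilsRec` — [Balaban1985RegularSpaces] (1.91) p. 91 ∕ (1.95) p. 92 AT THE FLAT BACKGROUND `U₀ = 1`, FOR THE RECORD's AVERAGING STRUCTURE
# ([Balaban1987RG1] (0.3): CENTRED blocks): the operators `Q′_j`, `Q′ᵀ`, `Q′ᵀaQ′` of the Dirichlet operator `Δ + Q′ᵀaQ′` read as FINITE REAL STENCILS on `ℤᵈ` with the centred block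
# labels `flmZ L j`, and the KERNEL FORM of the flat operator on functions supported in a finite region — the record twin of `B8Eq191FlatStencils` §3 (second half)–§4 (R6, δ sub-chain)

statement-level skeleton of published theorems with citation tags; proofs where landed; nothing here is a claim about the Yang–Mills mass gap

CITATION HEADER (lean-in-tree rule).  Cell `pub-ymgap` (HUMAN RULING D-0062), «N05-REC» road (director-ym №254∕№255; LEAD PEN dag-n05-e g37; `N05-REC-INVENTORY.md` §R6 row `B8Eq191FlatStencils —
A: … QprimeIter_flat_eq_sum_of_supp, flatDirichletOp_eq_sum_of_supp, QTaQ_flat_eq_sum_of_supp`; desk `R6-PLAN.md` §2 (d)).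
[6] = [Balaban1985RegularSpaces] (1.91) p. 91, (1.95) p. 92, (1.29) p. 81 (`paper:balaban1985-cmp99-regular-spaces`); [4] = [Balaban1985BackgroundPropagators] (3.19) p. 393, (3.23)–(3.25)
p. 394; [3] = [Balaban1985Averaging] (212) p. 50, (3) p. 17; [I] = [Balaban1987RG1] (0.3) p. 252.  `--kind proof --supports stmt-QuantumFields-20541` (K0⁷; count-neutral; no definition).
TOKEN MAP (engine → this file): (T2) `blockMap (Lʲ) x ↦ B8Eq119TwistedAxialRec.flmZ L j x` (the CENTRED `Lʲ`-block label; `= (B8Ineq130Rec.fl L)^[j] x`, `iterate_fl_eq_flmZ`, odd `L`),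
`blockSites ↦ B7SectEFLinearisationRec.blockSitesZ`, `zdBlocking ↦ zdBlockingZ`, `bgT ↦ bgTZ`, `qprimeT1 ∕ QprimeT ∕ QT ↦ B8Eq138LandauZdRec.qprimeT1Z ∕ QprimeTZ ∕ QTZ` (dag-n05-d);
REUSED BY NAME (not restated): the flat record transposes `B8Eq138LandauFlatOrthogonalRec.{qprimeT1Z_flat_apply, QprimeTZ_flat_apply, QTZ_flat_apply}` (dag-n05-d — the twins of the
engine's §3 first half), the class-0 flat Laplacian kernel `covLap_flat_eq_sum_of_supp` and the Kronecker-sum lemmas of the engine file §1–§2 (no block geometry in them).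

WHAT IS PROVED (sorry-free; odd `L` where the centred labels enter).  §1 the flat record average `Q′_j(1)`: `mem_blockSitesZ_iff_fl` (`x ∈ B(y) ↔ fl x = y`), `QprimeIterZ_flat_succ`
(one centred block mean), ★`QprimeIterZ_flat_eq_sum_of_supp` (`(Q′_j(1)h)(y) = Σ_{z∈S} L^{−dj}[flmZ L j z = y]•h(z)` for `h` supported in `S`), `QprimeIter_bgTZ_one`.  §2 ★`QTaQZ_flat_eq_sum_of_supp`
(the Gram kernel `Σ_j a_j L^{−2dj}[flmZ_j x ∈ Λ_j ∧ flmZ_j z = flmZ_j x]`), ★★`flatDirichletOpZ_eq_sum_of_supp` — THE KERNEL FORM OF THE FLAT DIRICHLET OPERATOR `Δ + Q′ᵀaQ′` OF (1.91)∕(1.95)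
FOR THE RECORD BLOCKING on `S`-supported functions, `K = K_Δ + K_Q` real and symmetric.
HONEST SCOPE.  Finite bookkeeping of the tree's concrete definitions at the flat background; no estimate; nothing of [4]∕[6]∕[I] asserted; `HThm4Rec` UNDISCHARGED; N05 ∕ N07 NOT
discharged; counts unmoved (typed 28∕28 · discharged 8∕28); one finite 𝕋⁴ programme at fixed ε — nothing continuum ∕ ℝ⁴ ∕ OS ∕ mass gap ∕ Clay.  No `def`, no `instance`, no `notation`,
no `sorry`.
-/

set_option autoImplicit false

noncomputable section

open scoped BigOperators

namespace Literature.MathematicalPhysics.QuantumFieldTheory.Balaban1983to89.B8Eq191FlatStencilsRec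

open Finset
open B7Prop1Explicit (e)
open B7Eq78Linearization (conjR conjR_apply Qprime_apply QprimeIter QprimeIter_zero QprimeIter_succ)
open B8Ineq130Rec (fl)
open B7SectEFLinearisationRec (zdBlockingZ blockSitesZ mem_blockSitesZ bgTZ)
open B8Eq119TwistedAxialRec (flmZ bgTZ_one fl_eq_flmZ_one iterate_fl_eq_flmZ mem_blockSitesZ_pow_iff_flmZ)
open B8Eq138LandauZd (covDivB covLap)
open B8Eq138LandauZdRec (qprimeT1Z QprimeTZ QTZ)
open B8Eq138LandauFlatOrthogonalRec (qprimeT1Z_flat_apply QprimeTZ_flat_apply QTZ_flat_apply)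
open B8Eq191FlatStencils (conjR_unitOne conjR_unitOne_inv covLap_flat_eq_sum_of_supp sum_ite_smul_eq_apply apply_eq_sum_ite_smul_of_supp sum_mul_ite_smul_eq inv_pow_mul_eq)

export B7Prop1Explicit (Site)

variable {d : ℕ}

section Flat

variable {𝔸 : Type*} [NormedRing 𝔸] [NormedAlgebra ℂ 𝔸] [CompleteSpace 𝔸] (L : ℕ)

/-! ## §1 The flat record average `Q′_j(1)` of a function supported in a finite set -/

omit [NormedAlgebra ℂ 𝔸] [CompleteSpace 𝔸] in
/-- Membership in the centred block through the centred floor: `x ∈ B(y) ↔ fl x = y` (odd `L`). [cite: Balaban1987RG1, (0.3) p.252 (bookkeeping)] -/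
theorem mem_blockSitesZ_iff_fl (hL : Odd L) (y x : Site d) : x ∈ blockSitesZ L y ↔ fl L x = y := by
  have h := mem_blockSitesZ_pow_iff_flmZ (d := d) hL 1 y x
  rw [pow_one] at h
  rw [h, fl_eq_flmZ_one]

omit [CompleteSpace 𝔸] in
/-- **One step of the flat record average**: `(Q′_{j+1}(1)h)(y) = Σ_{x ∈ B(y)} L⁻ᵈ·(Q′_j(1)h)(x)` over the CENTRED block `B(y) = blockSitesZ L y` (transporters `1`).
[cite: Balaban1985BackgroundPropagators, (3.19) p.393; Balaban1985Averaging, (212) p.50; Balaban1987RG1, (0.3) p.252] -/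
theorem QprimeIterZ_flat_succ (j : ℕ) (h : Site d → 𝔸) (y : Site d) :
    QprimeIter (zdBlockingZ d L) (fun _ _ _ => (1 : 𝔸ˣ)) (j + 1) h y
      = ∑ x ∈ blockSitesZ L y, (((L : ℝ) ^ d)⁻¹) • QprimeIter (zdBlockingZ d L) (fun _ _ _ => (1 : 𝔸ˣ)) j h x := by
  rw [QprimeIter_succ, Qprime_apply]
  refine Finset.sum_congr rfl fun x _ => ?_
  show (((L : ℝ) ^ d)⁻¹) • conjR (1 : 𝔸ˣ) _ = _
  rw [conjR_unitOne]

omit [CompleteSpace 𝔸] in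
open Classical in
/-- ★ (RECORD TWIN of `QprimeIter_flat_eq_sum_of_supp`.) **The flat record average `Q′_j(1)` of a function supported in a finite set `S`, as a sum over `S`** (any `y ∈ ℤᵈ`, odd `L`):
`(Q′_j(1)h)(y) = Σ_{z∈S} L^{−dj}[flmZ L j z = y]•h(z)` — the plain mean of `h` over the CENTRED `Lʲ`-block `Bʲ(y) = {z : flmZ L j z = y}`.
[cite: Balaban1985BackgroundPropagators, (3.19) p.393; Balaban1985Averaging, (212) p.50, (3) p.17; Balaban1987RG1, (0.3) p.252] -/
theorem QprimeIterZ_flat_eq_sum_of_supp (hL : Odd L) (S : Finset (Site d)) (h : Site d → 𝔸) (hs : ∀ w, w ∉ S → h w = 0) :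
    ∀ (j : ℕ) (y : Site d), QprimeIter (zdBlockingZ d L) (fun _ _ _ => (1 : 𝔸ˣ)) j h y
      = ∑ z ∈ S, (if flmZ L j z = y then (((L : ℝ) ^ d)⁻¹) ^ j else 0) • h z
  | 0, y => by
    rw [QprimeIter_zero, apply_eq_sum_ite_smul_of_supp S h hs y]
    refine Finset.sum_congr rfl fun z _ => ?_
    have h0 : flmZ L 0 z = z := by funext i; simp [flmZ]
    simp only [h0, pow_zero]
  | j + 1, y => by
    rw [QprimeIterZ_flat_succ]
    have ih : ∀ x : Site d, QprimeIter (zdBlockingZ d L) (fun _ _ _ => (1 : 𝔸ˣ)) j h x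
        = ∑ z ∈ S, (if flmZ L j z = x then (((L : ℝ) ^ d)⁻¹) ^ j else 0) • h z := QprimeIterZ_flat_eq_sum_of_supp hL S h hs j
    simp_rw [ih, Finset.smul_sum, smul_smul]
    rw [Finset.sum_comm]
    refine Finset.sum_congr rfl fun z _ => ?_
    rw [← Finset.sum_smul]
    congr 1
    -- `Σ_{x ∈ B(y)} L⁻ᵈ·L^{−dj}[flmZ_j z = x] = L^{−d(j+1)}[flmZ_{j+1} z = y]`
    have hkey : ∀ x : Site d, x ∈ blockSitesZ L y → ((((L : ℝ) ^ d)⁻¹) * (if flmZ L j z = x then (((L : ℝ) ^ d)⁻¹) ^ j else 0))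
        = if x = flmZ L j z then (((L : ℝ) ^ d)⁻¹) ^ (j + 1) else 0 := by
      intro x _
      by_cases hx : flmZ L j z = x
      · rw [if_pos hx, if_pos hx.symm, pow_succ]; ring
      · rw [if_neg hx, if_neg (fun h' => hx h'.symm), mul_zero]
    rw [Finset.sum_congr rfl hkey, Finset.sum_ite_eq' (blockSitesZ L y) (flmZ L j z)]
    have hstep : flmZ L (j + 1) z = y ↔ flmZ L j z ∈ blockSitesZ L y := by
      rw [mem_blockSitesZ_iff_fl L hL, ← iterate_fl_eq_flmZ hL j, ← iterate_fl_eq_flmZ hL (j + 1), Function.iterate_succ_apply']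
    by_cases hy : flmZ L (j + 1) z = y
    · rw [if_pos hy, if_pos (hstep.1 hy)]
    · rw [if_neg hy, if_neg (fun h' => hy (hstep.2 h'))]

/-! ## §2 The kernel form of `Q′ᵀaQ′` and of the flat Dirichlet operator `Δ + Q′ᵀaQ′`, record blocking -/

open Classical in
/-- ★ (RECORD TWIN of `QTaQ_flat_eq_sum_of_supp`.) **The kernel form of `Q′(1)ᵀaQ′(1)` on `S`-supported functions, centred blocking** (`a = (a_j)` real level weights, `Q′` read on
`{Λ_j}_{j ≤ m}` and zero elsewhere, odd `L`): `(Q′ᵀaQ′h)(x) = Σ_{z∈S} K_Q(x, z)•h(z)`, `K_Q(x, z) = Σ_{j ≤ m} a_j L^{−2dj}[flmZ_j x ∈ Λ_j ∧ flmZ_j z = flmZ_j x]` — a Gram kernel.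
[cite: Balaban1985BackgroundPropagators, (3.24) p.394, (3.19) p.393; Balaban1985RegularSpaces, (1.91) p.91; Balaban1987RG1, (0.3) p.252] -/
theorem QTaQZ_flat_eq_sum_of_supp (hL : Odd L) (m : ℕ) (Λs : ℕ → Set (Site d)) (a : ℕ → ℝ) (S : Finset (Site d))
    (h : Site d → 𝔸) (hs : ∀ w, w ∉ S → h w = 0) (x : Site d) :
    QTZ L m Λs (1 : Site d → Fin d → 𝔸ˣ)
        (fun j w => a j • (if j ≤ m then (Λs j).indicator (QprimeIter (zdBlockingZ d L) (fun _ _ _ => (1 : 𝔸ˣ)) j h) w else 0)) x =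
      ∑ z ∈ S, (∑ j ∈ Finset.range (m + 1), (if flmZ L j x ∈ Λs j ∧ flmZ L j z = flmZ L j x then
        a j * ((((L : ℝ) ^ d)⁻¹) ^ j) ^ 2 else 0)) • h z := by
  classical
  rw [QTZ_flat_apply hL]
  have hterm : ∀ j ∈ Finset.range (m + 1),
      (((L : ℝ) ^ d)⁻¹) ^ j • (Λs j).indicator (fun w => a j • (if j ≤ m then
        (Λs j).indicator (QprimeIter (zdBlockingZ d L) (fun _ _ _ => (1 : 𝔸ˣ)) j h) w else 0)) (flmZ L j x) =
      ∑ z ∈ S, (if flmZ L j x ∈ Λs j ∧ flmZ L j z = flmZ L j x then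
        a j * ((((L : ℝ) ^ d)⁻¹) ^ j) ^ 2 else 0) • h z := by
    intro j hj
    have hjm : j ≤ m := Nat.lt_succ_iff.mp (Finset.mem_range.mp hj)
    by_cases hin : flmZ L j x ∈ Λs j
    · rw [Set.indicator_of_mem hin, if_pos hjm, Set.indicator_of_mem hin, QprimeIterZ_flat_eq_sum_of_supp L hL S h hs j,
        Finset.smul_sum, Finset.smul_sum]
      refine Finset.sum_congr rfl fun z _ => ?_
      rw [smul_smul, smul_smul]
      congr 1
      by_cases hz : flmZ L j z = flmZ L j x
      · rw [if_pos hz, if_pos ⟨hin, hz⟩]; ring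
      · rw [if_neg hz, if_neg (fun h => hz h.2)]; ring
    · rw [Set.indicator_of_notMem hin, smul_zero]
      symm
      exact Finset.sum_eq_zero fun z _ => by rw [if_neg (fun h => hin h.1), zero_smul]
  rw [Finset.sum_congr rfl hterm, Finset.sum_comm]
  refine Finset.sum_congr rfl fun z _ => ?_
  rw [Finset.sum_smul]

open Classical in
/-- ★★ (RECORD TWIN of `flatDirichletOp_eq_sum_of_supp`.) **THE KERNEL FORM OF THE FLAT DIRICHLET OPERATOR `Δ + Q′ᵀaQ′` OF (1.91) ∕ (1.95) AT `U₀ = 1`, RECORD BLOCKING, on functions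
supported in a finite set `S`** (read at any `x ∈ ℤᵈ`; for `x ∈ S` this is the matrix of the compression `SΔ′_aS` of [4] p. 394): `((Δ + Q′ᵀaQ′)h)(x) = Σ_{z∈S} K(x, z)•h(z)`,
`K = K_Δ + K_Q` real and symmetric, `K_Q` with the centred labels `flmZ L j` (odd `L`). [cite: Balaban1985RegularSpaces, (1.91) p.91, (1.95) p.92; Balaban1985BackgroundPropagators, (3.23)–(3.25) p.394; Balaban1987RG1, (0.3) p.252] -/
theorem flatDirichletOpZ_eq_sum_of_supp (η : ℝ) (hL : Odd L) (m : ℕ) (Λs : ℕ → Set (Site d)) (a : ℕ → ℝ)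
    (S : Finset (Site d)) (h : Site d → 𝔸) (hs : ∀ w, w ∉ S → h w = 0) (x : Site d) :
    covLap η (1 : Site d → Fin d → 𝔸ˣ) h x + QTZ L m Λs (1 : Site d → Fin d → 𝔸ˣ)
        (fun j w => a j • (if j ≤ m then (Λs j).indicator (QprimeIter (zdBlockingZ d L) (fun _ _ _ => (1 : 𝔸ˣ)) j h) w else 0)) x =
      ∑ z ∈ S, (((η ^ 2)⁻¹ * ∑ μ : Fin d, ((2 : ℝ) * (if z = x then (1 : ℝ) else 0) - (if z = x + e μ then (1 : ℝ) else 0)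
        - (if z = x - e μ then (1 : ℝ) else 0))) +
        (∑ j ∈ Finset.range (m + 1), (if flmZ L j x ∈ Λs j ∧ flmZ L j z = flmZ L j x then
          a j * ((((L : ℝ) ^ d)⁻¹) ^ j) ^ 2 else 0))) • h z := by
  classical
  rw [covLap_flat_eq_sum_of_supp η S h hs x, QTaQZ_flat_eq_sum_of_supp L hL m Λs a S h hs x, ← Finset.sum_add_distrib]
  exact Finset.sum_congr rfl fun z _ => (add_smul _ _ _).symm

/-- `bgTZ L 1` IS the constant-`1` transporter family used above (so every statement of §2–§3 reads verbatim for `QprimeIter (zdBlockingZ d L) (bgTZ L 1)`, the letter of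
`B8Eq138LandauZdRec.InR138Z` at the flat background). [cite: Balaban1985RegularSpaces, (1.29) p.81; Balaban1985Averaging, (78) p.30] -/
theorem QprimeIter_bgTZ_one (j : ℕ) (h : Site d → 𝔸) :
    QprimeIter (zdBlockingZ d L) (bgTZ L (1 : Site d → Fin d → 𝔸ˣ)) j h = QprimeIter (zdBlockingZ d L) (fun _ _ _ => (1 : 𝔸ˣ)) j h := by
  rw [bgTZ_one]

end Flat

end Literature.MathematicalPhysics.QuantumFieldTheory.Balaban1983to89.B8Eq191FlatStencilsRec
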